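import Summits.QuantumFields.BalabanUV.Beta.FP.HorizontalTailAssembly
import Summits.QuantumFields.BalabanUV.Beta.FP.HorizontalBookkeepingTailLetters

/-!
# `BalabanUV.Beta.FP.HorizontalBookkeepingEndLetters` — road «FP», N7 H-route, row H3-BOOK: THE END FROM ABSTRACT ℓ¹ TRANSPORT LETTERS — the twin of
# leaf-05-g8's `FP/HorizontalBookkeepingEnd.abs_secondMoment_sub_window_le_of_letters` with the sup profile `|w κ l x| ≤ (c/N⁵)e^{−(δ/N)|x|₁}` REPLACED by the three
# scaled ℓ¹ letters `Σ'|w| ≤ ℓ₀/N`, `Σ'(|x|₁+1)|w| ≤ ℓ₁`, `Σ'(|x|₁+1)⁷|w| ≤ ℓ₇·N⁶` (resp. by the exp-weighted ℓ¹ mass `Σ' e^{(δ/N)|x|₁}|w| ≤ c/N`)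
# ([folklore] composition BY NAME; nothing of the manuscripts)

HONEST DEPENDENCY (page 1, mandatory): continuum YM on T⁴ ⇐ BetaPertH ∧ nine spine estimates (0/9 proved); BetaPertH ⇐ (D1) ∧ (D4) ∧
CAP+tail; G-an2-4 gates asym, D1 and NE2/3/4.  HONEST FRAMING (cell contract, verbatim): «discharging `BetaPertH` makes Bałaban's UV
stability UNCONDITIONAL — a real constructive-QFT result; it is NOT the continuum limit and NOT the Clay problem.»  THIS MODULE composes BY NAME leaf-05-g8's
assembly-by-shape `FP/HorizontalTailAssembly.abs_secondMoment_sub_window_le` + its (a)-socket `hasSum_truncatedTransport` (← leaf-02-g5's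
`hasSum_coarse_secondMoment_truncK`) with leaf-02-g6's (b-T) from letters `FP/HorizontalBookkeepingTailLetters.summable_weight_transport_tail_sub_of_scaledLetters` ∕
`…_of_expL1`, `…TailSum.tail_apply_coarse`, `…TailSum.dressedEntry_truncK_add_tail` — the proof is leaf-05's `…End` proof with the (b-T) call swapped.  Every letter is a
HYPOTHESIS displayed in the signature; nothing cited, no `def`, no `Prop` fact, 0 sorry.  WHY: row IPROF-UNIF may deliver the transport data as ℓ¹ letters or as an
exp-weighted ℓ¹ mass rather than a `p = 5` sup profile (gan24-leaf-04-g37's located note; leaf-02-g6's `…TailLetters`); this END accepts either.  NOT hbook-discharged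
(letters remain), NOT `hasym`, NOT D1, NOT BetaPertH, NOT continuum, NOT Clay.

CONTENT: **`abs_secondMoment_sub_window_le_of_scaledLetters`** (constant `161·A_L`, `A_L := 4⁷·(16Cℓ₀² + C) + (5/4)⁷·Cℓ₀·(128·(4/3)⁷·ℓ₁ + 4096·16⁷·ℓ₇)`),
**`abs_secondMoment_sub_window_le_of_expL1`** (constant `161·A_E`, `A_E` = `A_L` at `ℓ₀ = c·e^δ`, `ℓ₁ = c·e^δ/δ`, `ℓ₇ = 5040·c·e^δ/δ⁷`); both:
`|B12Beta.secondMoment T μ ν − Σ_{z ∈ annulus 4 0 N} K μ ν z·z_μ·z_ν| ≤ U₀ + 161·A + (3·Cg + 67392·C) + |c₀|`, N-UNIFORM.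
Unit `b2b-balaban-beta-d1-formalise-leaf-02` (gen 6).
-/

noncomputable section

namespace Summit.QuantumFields.BalabanUV.Beta.FP.HorizontalBookkeepingEndLetters

open Finset Filter Topology
open Literature.Probability.LatticeModels (box annulus)
open Literature.MathematicalPhysics.QuantumFieldTheory.Balaban1983to89
open Literature.MathematicalPhysics.QuantumFieldTheory.Balaban1983to89.Beta
open B12Sec2to5 (l1)
open DyadicShell (Pt supNorm)
open DecimatedMomentSummable (ConstReproSum LinReproSum AbsMoment₂ summable_of_absMoment₂)
open DressedMomentNormalisation (EKer dressedEntry)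
open Summit.QuantumFields.BalabanUV.Beta.FP.HorizontalBookkeeping (truncK t0Defect)
open Summit.QuantumFields.BalabanUV.Beta.FP.HorizontalBookkeepingTail (nonneg_of_decay)
open Summit.QuantumFields.BalabanUV.Beta.FP.HorizontalBookkeepingTailSum (tail_apply_coarse dressedEntry_truncK_add_tail)
open Summit.QuantumFields.BalabanUV.Beta.FP.HorizontalBookkeepingTailLetters (summable_weight_transport_tail_sub_of_scaledLetters
  summable_weight_transport_tail_sub_of_expL1)
open Summit.QuantumFields.BalabanUV.Beta.FP.HorizontalTailAssembly (abs_secondMoment_sub_window_le hasSum_truncatedTransport)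

/-- [folklore] THE GLUE: from a `((v μ·v ν : ℤ) : ℝ)`-weighted summable tail difference to the assembler's `hb`. -/
theorem hasSum_hb {N : ℕ} (hN : 1 ≤ N) (K w : EKer 4) (μ ν : Fin 4)
    (hsum : Summable fun v : Pt => ((v μ * v ν : ℤ) : ℝ)
      * ((N : ℝ) ^ 8 * dressedEntry w (K - truncK K N) ((N : ℤ) • v) μ ν - (N : ℝ) ^ 6 * (K - truncK K N) μ ν ((N : ℤ) • v))) :
    HasSum (fun v : Pt =>
      ((N : ℝ) ^ 8 * dressedEntry w (K - truncK K N) ((N : ℤ) • v) μ ν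
        - (if 1 < supNorm v then (N : ℝ) ^ 6 * K μ ν ((N : ℤ) • v) else 0)) * (v μ : ℝ) * (v ν : ℝ))
      (∑' v : Pt, ((v μ * v ν : ℤ) : ℝ) * ((N : ℝ) ^ 8 * dressedEntry w (K - truncK K N) ((N : ℤ) • v) μ ν
        - (N : ℝ) ^ 6 * (K - truncK K N) μ ν ((N : ℤ) • v))) := by
  refine hsum.hasSum.congr_fun fun v => ?_
  rw [tail_apply_coarse hN K μ ν v]
  by_cases h1 : supNorm v ≤ 1
  · rw [if_pos h1, if_neg (by omega)]; push_cast; ring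
  · rw [if_neg h1, if_pos (by omega)]; push_cast; ring

/-- [folklore] **THE HORIZONTAL BOOKKEEPING BOUND FROM ABSTRACT SCALED ℓ¹ TRANSPORT LETTERS.**  As `HorizontalBookkeepingEnd.abs_secondMoment_sub_window_le_of_letters`
with the sup profile replaced by `Σ'|w κ l| ≤ ℓ₀/N`, `Σ'(|x|₁+1)|w κ l x| ≤ ℓ₁`, `Σ'(|x|₁+1)⁷|w κ l x| ≤ ℓ₇·N⁶` (+ summability of the weight-7 family);
the conclusion is N-UNIFORM. -/
theorem abs_secondMoment_sub_window_le_of_scaledLetters {K w : EKer 4} {C ℓ₀ ℓ₁ ℓ₇ : ℝ} {N : ℕ} (hN : 1 ≤ N)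
    -- kernel letters
    (hK : ∀ c' e (t : Pt), |K c' e t| ≤ C / ((supNorm t : ℝ) + 1) ^ 6)
    (hdK : ∀ c' e (t : Pt) (i : Fin 4), |K c' e (t + Pi.single i 1) - K c' e t| ≤ C / ((supNorm t : ℝ) + 1) ^ 7)
    (heven : ∀ c' e (t : Pt), K c' e (-t) = K c' e t)
    -- transport letters
    (Cw : Fin 4 → Fin 4 → Fin 4 → ℝ)
    (hw0 : ∀ κ l, ConstReproSum N (w κ l) (if κ = l then (((N : ℝ) ^ (4 + 1))⁻¹) else 0))
    (hw1 : ∀ κ l, LinReproSum N (w κ l) (Cw κ l)) (hwA : ∀ κ l, AbsMoment₂ (w κ l))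
    (hwS : ∀ κ l, Summable fun x => (l1 x + 1) ^ 7 * |w κ l x|)
    (hL0 : ∀ κ l, ∑' x, |w κ l x| ≤ ℓ₀ / N) (hL1 : ∀ κ l, ∑' x, (l1 x + 1) * |w κ l x| ≤ ℓ₁)
    (hL7 : ∀ κ l, ∑' x, (l1 x + 1) ^ 7 * |w κ l x| ≤ ℓ₇ * (N : ℝ) ^ 6)
    -- (H1) at kernel level for the transported kernel, channel `(μ, ν)`
    {T D : EKer 4} (μ ν : Fin 4)
    (hH1 : ∀ v : Pt, (N : ℝ) ^ 8 * dressedEntry w K ((N : ℤ) • v) μ ν = T μ ν v + K μ ν v + D μ ν v)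
    (hT : Summable fun v : Pt => T μ ν v * (v μ : ℝ) * (v ν : ℝ))
    (hD : HasSum (fun v : Pt => D μ ν v * (v μ : ℝ) * (v ν : ℝ)) 0)
    -- the size of the truncated-transport defect
    {U₀ : ℝ} (hU0 : (N : ℝ) ^ 6 * |t0Defect N w (truncK K N) Cw μ ν μ ν| ≤ U₀)
    -- the log-asymptotics letter of the window function
    {s c₀ Cg : ℝ}
    (hgerm : ∀ M : ℕ, 1 ≤ M → |∑ z ∈ annulus 4 0 M, K μ ν z * (z μ : ℝ) * (z ν : ℝ) - (s * Real.log M + c₀)| ≤ Cg) :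
    let AL : ℝ := (4 : ℝ) ^ 7 * (16 * C * ℓ₀ ^ 2 + C) + (5 / 4 : ℝ) ^ 7 * (C * ℓ₀ * (128 * (4 / 3 : ℝ) ^ 7 * ℓ₁ + 4096 * 16 ^ 7 * ℓ₇))
    |B12Beta.secondMoment T μ ν - ∑ z ∈ annulus 4 0 N, K μ ν z * (z μ : ℝ) * (z ν : ℝ)|
      ≤ U₀ + 161 * AL + (3 * Cg + 67392 * C) + |c₀| := by
  intro AL
  have hC : 0 ≤ C := nonneg_of_decay hK μ ν
  set X : Pt → ℝ := fun v => (N : ℝ) ^ 8 * dressedEntry w K ((N : ℤ) • v) μ ν with hX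
  set Xtr : Pt → ℝ := fun v => (N : ℝ) ^ 8 * dressedEntry w (truncK K N) ((N : ℤ) • v) μ ν with hXtr
  set Xtl : Pt → ℝ := fun v => (N : ℝ) ^ 8 * dressedEntry w (K - truncK K N) ((N : ℤ) • v) μ ν with hXtl
  have hwS0 : ∀ κ l, Summable fun x => |w κ l x| := fun κ l => (summable_of_absMoment₂ (hwA κ l)).abs
  have hsplit : ∀ v, X v = Xtr v + Xtl v := by
    intro v
    simp only [hX, hXtr, hXtl]
    rw [← dressedEntry_truncK_add_tail (N := N) hK hwS0 ((N : ℤ) • v) μ ν]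
    ring
  have ha := hasSum_truncatedTransport hN w K Cw hw0 hw1 hwA heven μ ν
  have hE₀ : |(N : ℝ) ^ 6 * t0Defect N w (truncK K N) Cw μ ν μ ν| ≤ U₀ := by
    rw [abs_mul, abs_of_nonneg (by positivity)]; exact hU0
  obtain ⟨-, hsum, htsum, -⟩ := summable_weight_transport_tail_sub_of_scaledLetters hN hK hdK hw0 hwS hL0 hL1 hL7 μ ν μ ν
  have hb := hasSum_hb hN K w μ ν hsum
  exact abs_secondMoment_sub_window_le (K := K) (T := T) (D := D) (μ := μ) (ν := ν) hN hsplit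
    (by intro v; rw [← hH1 v]) hT hD ha hE₀ hb htsum hC (hK μ ν) (fun z i => hdK μ ν z i) hgerm

/-- [folklore] **THE HORIZONTAL BOOKKEEPING BOUND UNDER THE EXPONENTIALLY WEIGHTED ℓ¹ TRANSPORT MASS** `Σ'_x e^{(δ/N)|x|₁}|w κ l x| ≤ c/N` (summable,
`δ > 0`): as above with `A_E` (`= A_L` at `ℓ₀ = c·e^δ`, `ℓ₁ = c·e^δ/δ`, `ℓ₇ = 5040·c·e^δ/δ⁷`); N-UNIFORM. -/
theorem abs_secondMoment_sub_window_le_of_expL1 {K w : EKer 4} {C c δ : ℝ} {N : ℕ} (hN : 1 ≤ N) (hδ : 0 < δ)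
    -- kernel letters
    (hK : ∀ c' e (t : Pt), |K c' e t| ≤ C / ((supNorm t : ℝ) + 1) ^ 6)
    (hdK : ∀ c' e (t : Pt) (i : Fin 4), |K c' e (t + Pi.single i 1) - K c' e t| ≤ C / ((supNorm t : ℝ) + 1) ^ 7)
    (heven : ∀ c' e (t : Pt), K c' e (-t) = K c' e t)
    -- transport letters
    (Cw : Fin 4 → Fin 4 → Fin 4 → ℝ)
    (hw0 : ∀ κ l, ConstReproSum N (w κ l) (if κ = l then (((N : ℝ) ^ (4 + 1))⁻¹) else 0))
    (hw1 : ∀ κ l, LinReproSum N (w κ l) (Cw κ l)) (hwA : ∀ κ l, AbsMoment₂ (w κ l))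
    (hwE : ∀ κ l, Summable fun x => Real.exp (δ / N * l1 x) * |w κ l x|)
    (hwEb : ∀ κ l, ∑' x, Real.exp (δ / N * l1 x) * |w κ l x| ≤ c / N)
    -- (H1) at kernel level for the transported kernel, channel `(μ, ν)`
    {T D : EKer 4} (μ ν : Fin 4)
    (hH1 : ∀ v : Pt, (N : ℝ) ^ 8 * dressedEntry w K ((N : ℤ) • v) μ ν = T μ ν v + K μ ν v + D μ ν v)
    (hT : Summable fun v : Pt => T μ ν v * (v μ : ℝ) * (v ν : ℝ))
    (hD : HasSum (fun v : Pt => D μ ν v * (v μ : ℝ) * (v ν : ℝ)) 0)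
    -- the size of the truncated-transport defect
    {U₀ : ℝ} (hU0 : (N : ℝ) ^ 6 * |t0Defect N w (truncK K N) Cw μ ν μ ν| ≤ U₀)
    -- the log-asymptotics letter of the window function
    {s c₀ Cg : ℝ}
    (hgerm : ∀ M : ℕ, 1 ≤ M → |∑ z ∈ annulus 4 0 M, K μ ν z * (z μ : ℝ) * (z ν : ℝ) - (s * Real.log M + c₀)| ≤ Cg) :
    let AE : ℝ := (4 : ℝ) ^ 7 * (16 * C * (c * Real.exp δ) ^ 2 + C)
        + (5 / 4 : ℝ) ^ 7 * (C * (c * Real.exp δ) * (128 * (4 / 3 : ℝ) ^ 7 * (c * Real.exp δ / δ) + 4096 * 16 ^ 7 * (5040 * c * Real.exp δ / δ ^ 7)))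
    |B12Beta.secondMoment T μ ν - ∑ z ∈ annulus 4 0 N, K μ ν z * (z μ : ℝ) * (z ν : ℝ)|
      ≤ U₀ + 161 * AE + (3 * Cg + 67392 * C) + |c₀| := by
  intro AE
  have hC : 0 ≤ C := nonneg_of_decay hK μ ν
  set X : Pt → ℝ := fun v => (N : ℝ) ^ 8 * dressedEntry w K ((N : ℤ) • v) μ ν with hX
  set Xtr : Pt → ℝ := fun v => (N : ℝ) ^ 8 * dressedEntry w (truncK K N) ((N : ℤ) • v) μ ν with hXtr
  set Xtl : Pt → ℝ := fun v => (N : ℝ) ^ 8 * dressedEntry w (K - truncK K N) ((N : ℤ) • v) μ ν with hXtl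
  have hwS0 : ∀ κ l, Summable fun x => |w κ l x| := fun κ l => (summable_of_absMoment₂ (hwA κ l)).abs
  have hsplit : ∀ v, X v = Xtr v + Xtl v := by
    intro v
    simp only [hX, hXtr, hXtl]
    rw [← dressedEntry_truncK_add_tail (N := N) hK hwS0 ((N : ℤ) • v) μ ν]
    ring
  have ha := hasSum_truncatedTransport hN w K Cw hw0 hw1 hwA heven μ ν
  have hE₀ : |(N : ℝ) ^ 6 * t0Defect N w (truncK K N) Cw μ ν μ ν| ≤ U₀ := by
    rw [abs_mul, abs_of_nonneg (by positivity)]; exact hU0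
  obtain ⟨-, hsum, htsum, -⟩ := summable_weight_transport_tail_sub_of_expL1 hN hδ hK hdK hw0 hwE hwEb μ ν μ ν
  have hb := hasSum_hb hN K w μ ν hsum
  exact abs_secondMoment_sub_window_le (K := K) (T := T) (D := D) (μ := μ) (ν := ν) hN hsplit
    (by intro v; rw [← hH1 v]) hT hD ha hE₀ hb htsum hC (hK μ ν) (fun z i => hdK μ ν z i) hgerm

end Summit.QuantumFields.BalabanUV.Beta.FP.HorizontalBookkeepingEndLetters

end
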